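import Summits.Langlands.Langlands.Theses.EisensteinMonodromy
import Summits.Langlands.Langlands.Theorems.GenericWDUniqueConj
import Literature.RepresentationTheory.Semisimple.EquivOfCharacter
import HarnessLib

/-!
# `EisensteinMonodromy.GenericWDUnique` (stmt-Langlands-2374) — proved outright

Item `stmt-Langlands-2374` (support, rank 9; wanted by the routes EisensteinMonodromy,
WeightVelocityMonodromy, SteinbergWeightVelocity, SteinbergVelocityDst, RootDecomp1, RootDecomp2,
RetentionCarving, PurityCarving): over an algebraically closed field `E` of characteristic `0`, two
Frobenius-semisimple GENERIC Weil–Deligne representations `W`, `W'` of `W_F` on `Fin n → E` with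
`tr W.ρ(w) = tr W'.ρ(w)` for all `w ∈ W_F` are isomorphic.
## Proof
* Frobenius-semisimple ⇒ `ρ`, `ρ'` semisimple (`isSemisimpleRepresentation_of_isFrobSemisimple`: the
  eigenspaces of a central Frobenius power are semisimple subrepresentations, part I, covering `V`);
* Brauer–Nesbitt in characteristic `0` for semisimple representations (tree,
  `Literature.RepresentationTheory.Semisimple.Representation.nonempty_equiv_of_character_eq_of_isSemisimple`,
  Bourbaki A VIII § 20 n° 6 Cor. a)) gives `φ : ρ ≃ ρ'`;
* transport `N'` along `φ`: `W'' = (V, ρ, φ⁻¹ N' φ)` is a Weil–Deligne representation with the SAME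
  `ρ` as `W`, generic because `W'` is, and `φ : W'' ≅ W'`;
* A'Campo–Hevesi–Thorne–Whitmore Prop. 6.0.5 over `E` (part II, `generic_conj`) gives `g ∈ G(ρ)`
  with `g N = (φ⁻¹ N' φ) g`, i.e. `g : W ≅ W''`; compose.
No Literature NAMED FACT is consumed (the `IsFrobPow`/local-field facts used are the tree's
discharged `_holds` theorems).  lens-3 g22 node twin (decomp-langlands), 2026-08-31.
-/

set_option linter.dupNamespace false

namespace Summit.Langlands.Langlands.Theorems

namespace GenericWDU

open Module
open Literature.NumberTheory.GaloisRepresentations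
open Literature.NumberTheory.GaloisRepresentations.WeilGroup
open Literature.NumberTheory.GaloisRepresentations.IsNonarchimedeanLocalField

/-- **Frobenius-semisimple ⇒ semisimple**, over an algebraically closed field of characteristic `0`
(Deligne, Antwerp II, 8.5–8.6).  If every `ρ(w)` is a semisimple endomorphism then `ρ` is a
semisimple representation of `W_F`: the eigenspaces of a central Frobenius power `ρ(Φᵐ)` are
subrepresentations on which `Φᵐ` acts by a non-zero scalar, hence semisimple
(`isSemisimpleRepresentation_of_frobenius_scalar`), and they cover `V`.
(Tree: `WeilDeligneRep.IsFrobSemisimple.isSemisimpleRepresentation`, the case `C = ℂ`; same proof.) -/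
theorem isSemisimpleRepresentation_of_isFrobSemisimple
    {F : Type*} [Field F] [ValuativeRel F] [TopologicalSpace F] [IsNonarchimedeanLocalField F]
    {C : Type*} [Field C] [CharZero C] [IsAlgClosed C]
    {V : Type*} [AddCommGroup V] [Module C V] [FiniteDimensional C V]
    {r : WeilDeligneRep F C V} (hr : r.IsFrobSemisimple) :
    r.ρ.IsSemisimpleRepresentation := by
  classical
  obtain ⟨Φ, hΦ⟩ := WeilDeligneRep.exists_deg_eq_one (F := F)
  obtain ⟨m, hm, hcomm⟩ := r.exists_commute_pow_of_mem_inertia Φ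
  have hz : ∀ w : WeilGroup F, Commute (r.ρ (Φ ^ m)) (r.ρ w) :=
    r.commute_ρ_pow_of_forall_inertia hΦ hcomm
  have hT : Module.End.IsSemisimple (r.ρ (Φ ^ m)) := hr (Φ ^ m)
  -- finitely many values on inertia
  have hfinI : ((fun w => r.ρ w) '' (inertia F : Set (WeilGroup F))).Finite := by
    refine ((WeilDeligneRep.finite_image_inertia r).image
      (Units.val : (V →ₗ[C] V)ˣ → (V →ₗ[C] V))).subset ?_
    rintro _ ⟨w, hw, rfl⟩
    exact ⟨r.ρ.toHomUnits w, ⟨w, hw, rfl⟩, rfl⟩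
  -- the eigenspaces `V_μ` of the central `ρ(Φᵐ)` are subrepresentations
  let E : C → Subrepresentation r.ρ := fun μ =>
    { toSubmodule := Module.End.eigenspace (r.ρ (Φ ^ m)) μ
      apply_mem_toSubmodule := fun w v hv => by
        rw [Module.End.mem_eigenspace_iff] at hv ⊢
        calc r.ρ (Φ ^ m) (r.ρ w v) = (r.ρ (Φ ^ m) * r.ρ w) v := rfl
          _ = (r.ρ w * r.ρ (Φ ^ m)) v := by rw [(hz w).eq]
          _ = r.ρ w (r.ρ (Φ ^ m) v) := rfl
          _ = μ • r.ρ w v := by rw [hv, map_smul] }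
  -- the non-zero eigenspaces cover `V`
  let ι := {μ : C // Module.End.eigenspace (r.ρ (Φ ^ m)) μ ≠ ⊥}
  have htop : ⨆ i : ι, (E i.1).toSubmodule = ⊤ :=
    (iSup_ne_bot_subtype fun μ : C => Module.End.eigenspace (r.ρ (Φ ^ m)) μ).trans
      hT.iSup_eigenspace_eq_top
  refine Representation.isSemisimpleRepresentation_of_iSup_toSubmodule_eq_top
    (fun i : ι => E i.1) (fun i => ?_) htop
  -- on `V_μ ≠ 0` the eigenvalue `μ` of the invertible `ρ(Φᵐ)` is non-zero
  have hμ : (i.1 : C) ≠ 0 := by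
    intro h0
    apply i.2
    rw [h0, Module.End.eigenspace_zero, LinearMap.ker_eq_bot]
    exact ((Module.End.isUnit_iff _).mp (r.ρ.toHomUnits (Φ ^ m)).isUnit).1
  exact isSemisimpleRepresentation_of_frobenius_scalar r.ρ hΦ hm _ hμ
    (fun x hx => Module.End.mem_eigenspace_iff.mp hx) hfinI

/-- **Frobenius-semisimple generic Weil–Deligne representations are determined by their Weil
traces** (possibly on different spaces), over an algebraically closed field of characteristic `0`:
Brauer–Nesbitt transport ∘ `generic_conj`. -/
theorem isEquivalent_of_trace_eq_of_generic
    {K : Type*} [Field K] [ValuativeRel K] [TopologicalSpace K] [IsNonarchimedeanLocalField K]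
    {C : Type*} [Field C] [CharZero C] [IsAlgClosed C]
    {V : Type*} [AddCommGroup V] [Module C V] [FiniteDimensional C V]
    {V' : Type*} [AddCommGroup V'] [Module C V'] [FiniteDimensional C V']
    (W : WeilDeligneRep K C V) (W' : WeilDeligneRep K C V')
    (hss : W.IsFrobSemisimple) (hss' : W'.IsFrobSemisimple)
    (htr : ∀ w : WeilGroup K, LinearMap.trace C V (W.ρ w) = LinearMap.trace C V' (W'.ρ w))
    (hW : ∀ f : V →ₗ[C] V,
      (∀ w : WeilGroup K, f ∘ₗ W.ρ w = ((residueFieldCard K : C) ^ (deg w)) • (W.ρ w ∘ₗ f)) →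
      f ∘ₗ W.N = W.N ∘ₗ f → f = 0)
    (hW' : ∀ f : V' →ₗ[C] V',
      (∀ w : WeilGroup K, f ∘ₗ W'.ρ w = ((residueFieldCard K : C) ^ (deg w)) • (W'.ρ w ∘ₗ f)) →
      f ∘ₗ W'.N = W'.N ∘ₗ f → f = 0) :
    W.IsEquivalent W' := by
  classical
  -- Brauer–Nesbitt: `φ : ρ ≃ ρ'`
  haveI := isSemisimpleRepresentation_of_isFrobSemisimple hss
  haveI := isSemisimpleRepresentation_of_isFrobSemisimple hss'
  obtain ⟨e⟩ :=
    Literature.RepresentationTheory.Semisimple.Representation.nonempty_equiv_of_character_eq_of_isSemisimple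
      W.ρ W'.ρ (funext htr)
  let φ : V ≃ₗ[C] V' := e.toLinearEquiv
  have hφ : ∀ w, (φ : V →ₗ[C] V') ∘ₗ W.ρ w = W'.ρ w ∘ₗ (φ : V →ₗ[C] V') :=
    fun w => e.toIntertwiningMap.isIntertwining' w
  have hφv : ∀ w v, φ (W.ρ w v) = W'.ρ w (φ v) := fun w v => by
    simpa using LinearMap.congr_fun (hφ w) v
  have hφs : ∀ w x, φ.symm (W'.ρ w x) = W.ρ w (φ.symm x) := fun w x => by
    apply φ.injective
    rw [LinearEquiv.apply_symm_apply, hφv, LinearEquiv.apply_symm_apply]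
  set q : C := (residueFieldCard K : C) with hq
  have hρN' : ∀ w x, W'.ρ w (W'.N x) = q ^ (deg w) • W'.N (W'.ρ w x) := fun w x => by
    simpa using LinearMap.congr_fun (W'.conj_N w) x
  -- the transported monodromy operator `N₁ = φ⁻¹ N' φ` on `V`
  let N₁ : V →ₗ[C] V := (φ.symm : V' →ₗ[C] V) ∘ₗ W'.N ∘ₗ (φ : V →ₗ[C] V')
  have hN₁ : ∀ v, N₁ v = φ.symm (W'.N (φ v)) := fun v => rfl
  have hN₁pow : ∀ k : ℕ, ∀ v, (N₁ ^ k) v = φ.symm ((W'.N ^ k) (φ v)) := by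
    intro k
    induction k with
    | zero => intro v; simp
    | succ k ih =>
      intro v
      rw [pow_succ, pow_succ, Module.End.mul_apply, hN₁, ih, Module.End.mul_apply,
        LinearEquiv.apply_symm_apply]
  let W'' : WeilDeligneRep K C V :=
    { ρ := W.ρ
      isContinuous := W.isContinuous
      N := N₁
      isNilpotent_N := by
        obtain ⟨k, hk⟩ := W'.isNilpotent_N
        refine ⟨k, LinearMap.ext fun v => ?_⟩
        rw [hN₁pow, hk, LinearMap.zero_apply, map_zero, LinearMap.zero_apply]
      conj_N := fun w => LinearMap.ext fun v => by
        change W.ρ w (N₁ v) = q ^ (deg w) • N₁ (W.ρ w v)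
        rw [hN₁, hN₁, ← hφs, hρN', map_smul, hφv] }
  -- `W''` is generic
  have hW'' : ∀ f : V →ₗ[C] V,
      (∀ w : WeilGroup K, f ∘ₗ W''.ρ w = (q ^ (deg w)) • (W''.ρ w ∘ₗ f)) →
      f ∘ₗ W''.N = W''.N ∘ₗ f → f = 0 := by
    intro f hf hfN
    have hfv : ∀ w v, f (W.ρ w v) = q ^ (deg w) • W.ρ w (f v) := fun w v => by
      simpa using LinearMap.congr_fun (hf w) v
    have hfNv : ∀ v, f (N₁ v) = N₁ (f v) := fun v => LinearMap.congr_fun hfN v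
    let f' : V' →ₗ[C] V' := (φ : V →ₗ[C] V') ∘ₗ f ∘ₗ (φ.symm : V' →ₗ[C] V)
    have hf' : ∀ x, f' x = φ (f (φ.symm x)) := fun x => rfl
    have h1 : ∀ w : WeilGroup K, f' ∘ₗ W'.ρ w = (q ^ (deg w)) • (W'.ρ w ∘ₗ f') := by
      intro w
      refine LinearMap.ext fun x => ?_
      change f' (W'.ρ w x) = q ^ (deg w) • W'.ρ w (f' x)
      rw [hf', hf', hφs, hfv, map_smul, hφv]
    have h2 : f' ∘ₗ W'.N = W'.N ∘ₗ f' := by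
      refine LinearMap.ext fun x => ?_
      change f' (W'.N x) = W'.N (f' x)
      rw [hf', hf']
      have hx : φ.symm (W'.N x) = N₁ (φ.symm x) := by
        rw [hN₁, LinearEquiv.apply_symm_apply]
      rw [hx, hfNv, hN₁, LinearEquiv.apply_symm_apply]
    have hf'0 : f' = 0 := hW' f' h1 h2
    refine LinearMap.ext fun v => ?_
    have h := hf' (φ v)
    rw [hf'0, LinearMap.zero_apply, LinearEquiv.symm_apply_apply] at h
    have h' := congrArg φ.symm h
    rw [map_zero, LinearEquiv.symm_apply_apply] at h'
    rw [LinearMap.zero_apply, ← h']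
  -- Prop. 6.0.5 over `C`: `g ∈ G(ρ)` with `g N = N₁ g`
  obtain ⟨G, hG, hGN⟩ := generic_conj W W'' rfl hss hW hW''
  have hGv : ∀ w v, G (W.ρ w v) = W.ρ w (G v) := fun w v => by
    simpa using LinearMap.congr_fun (hG w) v
  have hGNv : ∀ v, G (W.N v) = N₁ (G v) := fun v => by
    simpa using LinearMap.congr_fun hGN v
  -- the isomorphism `φ ∘ g : W ≅ W'`
  refine ⟨{ toRepEquiv := Representation.Equiv.mk (G ≪≫ₗ φ) (fun w => ?_), comm_N := ?_ }⟩
  · refine LinearMap.ext fun v => ?_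
    change φ (G (W.ρ w v)) = W'.ρ w (φ (G v))
    rw [hGv, hφv]
  · refine LinearMap.ext fun v => ?_
    change φ (G (W.N v)) = W'.N (φ (G v))
    rw [hGNv, hN₁, LinearEquiv.apply_symm_apply]

end GenericWDU

open Literature.NumberTheory.GaloisRepresentations in
/-- **Item stmt-Langlands-2374 `GenericWDUnique`, proved**: over an algebraically closed field of
characteristic `0`, two Frobenius-semisimple generic Weil–Deligne representations of `W_F` on
`Fin n → E` with equal Weil traces are isomorphic
(`GenericWDU.isEquivalent_of_trace_eq_of_generic`). -/
theorem GenericWDUnique_proof :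
    Summit.Langlands.Langlands.Theses.EisensteinMonodromy.GenericWDUnique := by
  intro F _ _ _ _ E _ _ _ n W W' hss hss' htr hW hW'
  exact GenericWDU.isEquivalent_of_trace_eq_of_generic W W' hss hss' htr hW hW'

end Summit.Langlands.Langlands.Theorems
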